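import Mathlib
import HarnessLib
import Summits.HubbardSuperconductivity.HubbardSuperconductivity.Theorems.ComplexGFFStiffnessHolomorphicTorusFamily

/-!
# Crux child `TwoKernelSkBound` (stmt-HubbardSuperconductivity-27414), line `banach_two_kernel`, stub
# `stub_f4l2ShrinkLoc` — the FREE-`H̃` holomorphy of `K_{k+1}` for the [ABKM19] torus step data

Route `route-HubbardSuperconductivity-ComplexGFFStiffness`, cruxes stmt-HubbardSuperconductivity-19154
`HypACumulant` / -19155 `HypALocalTwoPoint`; memo `Cruxes/HypACumulant/TWOKERNEL-PLAN-27414-v2.md` §9–§10.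

The second-order two-kernel slot (F4l2) for `S_q = K_{k+1}^{(q)}` is split along the four corners
`q, q+y, q+z, q+y+z` as `B1 + B2 + B3 + B4` with the two-slot object
`G(ρ, η) = nextK s π μ_ρ (e^{−H}) (e^{−H̃_η}) K` (kernel `ρ`, intermediate Hamiltonian of corner `η`).  The
point of this file: `nextK` ([ABKM19] (6.34), `RenormalisationStepAlgebra.nextK`) carries the intermediate
functional `Ĩ = e^{−H̃}` as an INDEPENDENT slot, and the structural holomorphy pass
`differentiableOn_nextK_family` (…HolomorphicStepFamily) is stated for an arbitrary affine line `H̃ + σŨ` in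
that slot.  Its two model obligations — measurability and a `σ`-uniform `μ_{k+1}`-integrable majorant of the
intermediate functional `Φ_σ(X, φ, ·)` on `k`-polymers — are discharged here for the torus step kernel exactly as
in the tied case `H̃ = nextH D H K` (S6c, `differentiableOn_nextKStep_abkm_lineAct`): the `H̃`-dependence of
`Φ_σ` sits in the field-local prefactor `(1 − e^{−(H̃+σŨ)})^{Y}(φ)` OUTSIDE the fluctuation variable, bounded
on the closed disc by compactness, and the rest is Lemma 8.3/9.3 at degree zero
(`tayNormLE_bprod_expNegH_mul_abkm`) times the integrable weight (`StepKernelBounds.integrable_weight`).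

* `differentiableOn_nextK_abkm_freeHt_lineAct` — for ANY `H̃, Ũ`: `σ ↦ nextK (L^k) π μ_{k+1}
  (e^{−(H+σU)}) (e^{−(H̃+σŨ)}) (mulExt (a + σ b)) U' φ` is holomorphic on every disc where `‖H + σU‖_{k,0} ≤ ⅛`
  (any reblocking map `π`; kernel by predicate `StepKernelBounds` at scale `k + 1 ≤ N`);
* `differentiable_nextK_abkm_freeHt` — state fixed (`U = 0`, `b = 0`, `‖H‖_{k,0} ≤ ⅛`): the map is ENTIRE in
  `σ` along every line `H̃ + σŨ` of the intermediate slot;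
* `differentiable_nextK_abkm_freeHt_bidisc` — the same along `H̃ + σŨ + τṼ`, separately in `σ` and in `τ`
  (the input shape of the bidisc Cauchy engine `weakNormLE_secondDiff_of_pointwise_holomorphic`).

These are the holomorphy inputs of the blocks B1 (pure `H̃`-parallelogram at fixed kernel) and B2/B3 (kernel
pair × `H̃`-shift) of the stub.  All proved, no `sorry`.  Honest scope: toolchain for a rung route (stiffness
of a complex Gaussian gradient field via the [ABKM19] RG); nothing about superconductivity in the Hubbard
model is claimed or advanced.

## References
* S. Adams, S. Buchholz, R. Kotecký, S. Müller, arXiv:1910.13564, Definition 6.5 (6.32)–(6.35), Lemma 8.3,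
  Lemma 8.4, Lemma 9.3, Lemma 12.6 (12.53) [AdamsBuchholzKoteckyMuller2019].
-/

noncomputable section

-- `Summit.<Summit>.<Problem>`: single-conjunct summit, the duplicate component is mandated (D-0017).
set_option linter.dupNamespace false

namespace Summit.HubbardSuperconductivity.HubbardSuperconductivity.Theorems.ComplexGFF

open MeasureTheory Metric Set
open scoped BigOperators
open Literature.MathematicalPhysics.StatisticalMechanics.GradientRG
open Literature.MathematicalPhysics.StatisticalMechanics.TorusPolymer (bprod blocks pcirc polys reblock IsPolymer mem_polys
  blockOf isConn_blockOf isPolymer_blockOf mem_blockOf_self polys_mono blocks_mono)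
open Literature.Barriers.CriticalPhenomena.LongRangePhi4.Polymer (IsConn components)
open Literature.MathematicalPhysics.StatisticalMechanics

variable {d M : ℕ} [NeZero M]

set_option maxHeartbeats 800000 in
/-- **Free-`H̃` holomorphy of `K_{k+1}` for the torus step.**  For the [ABKM19] weights/norms at `q = 0`, a step
kernel `𝒞_{k+1}` with `StepKernelBounds` (`k + 1 ≤ N`), admissible activities `a, b` and ANY pair `H̃, Ũ` of
relevant Hamiltonians, `σ ↦ nextK (L^k) π μ_{k+1} (e^{−(H+σU)}) (e^{−(H̃+σŨ)}) (mulExt (a + σ b)) U' φ` is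
holomorphic on every disc on which `‖H + σU‖_{k,0} ≤ ⅛` (pointwise in `U'`, `φ`; any reblocking map `π`).
[cite: AdamsBuchholzKoteckyMuller2019, Definition 6.5 (6.32)–(6.34) / Lemma 8.3 / Lemma 8.4] -/
theorem differentiableOn_nextK_abkm_freeHt_lineAct {L N Mord R n p r₀ : ℕ} {θbar lam μ δ₁ δ₀ A𝒫 A𝒫' C₂ h A : ℝ}
    {𝒞 : ℕ → (Fin d → ZMod M) → ℝ} (hd : 3 ≤ d) (hLodd : Odd L)
    (hM : M = L ^ N) {k : ℕ} (hkN : k + 1 ≤ N) (hp : d / 2 + 2 ≤ p) (hpM : p + d ≤ Mord)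
    (hB : AbkmWeightBounds L N Mord R n θbar lam μ δ₁ δ₀ A𝒫 𝒞
      (abkmWeightData L N Mord R θbar (schedDelta δ₀ δ₁ N) 𝒞))
    (hδ₀ : 0 < δ₀) (hδ₁ : 0 < δ₁) (hh : 0 < h) (hh0 : hZeroSq d R δ₀ δ₁ ≤ h ^ 2) (hA1 : 1 ≤ A)
    (π : Finset (Fin d → ZMod M) → Finset (Fin d → ZMod M)) (𝒞k : (Fin d → ZMod M) → ℝ)
    (hS : StepKernelBounds (abkmWeightData L N Mord R θbar (schedDelta δ₀ δ₁ N) 𝒞) L k A𝒫' C₂ 𝒞k)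
    (H U Ht Ut : RelevantHamiltonian ℂ d)
    {a b : Finset (Fin d → ZMod M) → ((Fin d → ZMod M) → ℝ) → ℂ} {Ca Cb : ℝ} (hCa : 0 ≤ Ca) (hCb : 0 ≤ Cb)
    (ha : WeakNormLE (abkmNormParams L N Mord R p r₀ h θbar A (schedDelta δ₀ δ₁ N) 𝒞) k a Ca)
    (hb : WeakNormLE (abkmNormParams L N Mord R p r₀ h θbar A (schedDelta δ₀ δ₁ N) 𝒞) k b Cb)
    (had : ∀ Y, ContDiff ℝ r₀ (a Y)) (hbd : ∀ Y, ContDiff ℝ r₀ (b Y))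
    (haloc : ∀ Y, IsPolymer (L ^ k) Y → IsConn Y →
      IsGaugeLocal ((abkmNormParams L N Mord R p r₀ h θbar A (schedDelta δ₀ δ₁ N) 𝒞).gauge k Y) (a Y))
    (hbloc : ∀ Y, IsPolymer (L ^ k) Y → IsConn Y →
      IsGaugeLocal ((abkmNormParams L N Mord R p r₀ h θbar A (schedDelta δ₀ δ₁ N) 𝒞).gauge k Y) (b Y))
    {Rb : ℝ} (hHR : ∀ σ ∈ ball (0 : ℂ) Rb, hamNorm (fieldWt h (L : ℝ) d k) ((L : ℝ) ^ k) (L ^ (d * k)) (H + σ • U) ≤ 1 / 8)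
    (U' : Finset (Fin d → ZMod M)) (φ : (Fin d → ZMod M) → ℝ) :
    DifferentiableOn ℂ (fun σ : ℂ => nextK (L ^ k) π (stepMeasure 𝒞k) (expNegH (H + σ • U))
      (expNegH (Ht + σ • Ut)) (mulExt ((a + σ • b))) U' φ) (ball (0 : ℂ) Rb) := by
  set P := abkmNormParams L N Mord R p r₀ h θbar A (schedDelta δ₀ δ₁ N) 𝒞 with hP
  set Wt := abkmWeightData L N Mord R θbar (schedDelta δ₀ δ₁ N) 𝒞 with hWt
  have hA : 0 < A := by linarith
  have hPA : 0 < P.A := hA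
  have hL0 : (0 : ℝ) < L := by exact_mod_cast hLodd.pos
  have hk1 : 1 ≤ L ^ k := Nat.one_le_pow _ _ hLodd.pos
  have hMo : Odd M := by rw [hM]; exact hLodd.pow
  -- the uniform weak-norm constant of the line on the disc
  set C : ℝ := Ca + max Rb 0 * Cb with hCdef
  have hC0 : 0 ≤ C := by positivity
  have hKσ : ∀ σ ∈ ball (0 : ℂ) Rb, WeakNormLE P k (mulExt ((a + σ • b))) C := by
    intro σ hσ
    have hσ' : ‖σ‖ ≤ max Rb 0 := (le_of_lt (mem_ball_zero_iff.1 hσ)).trans (le_max_left _ _)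
    refine weakNormLE_mulExt_iff.2 ((weakNormLE_lineAct ha hb had hbd σ).mono hPA ?_)
    nlinarith
  have hKd : ∀ σ Y, ContDiff ℝ r₀ (mulExt ((a + σ • b)) Y) := fun σ Y =>
    contDiff_mulExt (contDiff_lineAct had hbd σ) Y
  have hKloc : ∀ σ Y, IsPolymer (L ^ k) Y → IsConn Y → IsGaugeLocal (P.gauge k Y) (mulExt ((a + σ • b)) Y) :=
    fun σ Y hY hYc => isGaugeLocal_mulExt_conn (P.gauge k)
      (fun Y' hY' hY'c => isGaugeLocal_lineAct (haloc Y' hY' hY'c) (hbloc Y' hY' hY'c) σ) hY hYc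
  -- apply the structural pass for families, with the FREE intermediate line `Ht + σ • Ut`
  refine differentiableOn_nextK_family (L ^ k) π (stepMeasure 𝒞k) H U Ht Ut (fun σ => mulExt ((a + σ • b)))
    (fun Y ψ => differentiable_mulExt_lineAct a b Y ψ) U' φ ?_ ?_
  · -- measurability of `Φ_σ(X, φ, ·)`
    intro X hX σ
    exact (measurable_midK_snd hX (fun B _ => measurable_expNegH _ B)
      (fun Y _ => measurable_mulExt (fun Y' => (contDiff_lineAct had hbd σ Y').continuous.measurable) Y) φ).aestronglyMeasurable
  · -- the `σ`-uniform integrable bound of `Φ_σ(X, φ, ·)`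
    intro X hX
    -- prefactor bounds on the closed disc (the ONLY place where `Ht, Ut` enter: a field-local factor at `φ`)
    have hMY : ∀ Y : Finset (Fin d → ZMod M), ∃ MY : ℝ, ∀ σ ∈ closedBall (0 : ℂ) Rb,
        ‖bprod (L ^ k) (fun B => 1 - expNegH (Ht + σ • Ut) B φ) Y‖ ≤ MY := fun Y =>
      (isCompact_closedBall (0 : ℂ) Rb).exists_bound_of_continuousOn
        ((differentiable_bprod_one_sub_expNegH_line (L ^ k) Ht Ut Y φ).continuous.continuousOn)
    choose MY hMY using hMY
    -- the inner constant of Lemma 8.3 / 9.3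
    set cW : Finset (Fin d → ZMod M) → Finset (Fin d → ZMod M) → ℝ := fun W Z' =>
      (∏ _B ∈ blocks (L ^ k) W, Real.exp (1 / 4)) * ∏ Y' ∈ components Z', C * P.aFactor k Y' with hcW
    refine ⟨fun ξ => ∑ Y ∈ polys (L ^ k) X, ∑ Z ∈ polys (L ^ k) (X \ Y), ∑ W ∈ polys (L ^ k) Z,
      MY Y * (cW W ((X \ Y) \ Z) * Wt.weight k (W ∪ ((X \ Y) \ Z)) (φ + ξ)), ?_, ?_⟩
    · -- integrability: finite sums of weights
      refine integrable_finsetSum _ fun Y _ => integrable_finsetSum _ fun Z _ =>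
        integrable_finsetSum _ fun W _ => ?_
      exact ((hS.integrable_weight hB.dominated (W ∪ ((X \ Y) \ Z)) φ).const_mul _).const_mul _
    · -- the bound, term by term
      intro σ hσ ξ
      have hσc : σ ∈ closedBall (0 : ℂ) Rb := ball_subset_closedBall hσ
      have hHσ := hHR σ hσ
      rw [midK_eq_sum]
      refine (norm_sum_le _ _).trans (Finset.sum_le_sum fun Y hY => (norm_sum_le _ _).trans
        (Finset.sum_le_sum fun Z hZ => (norm_sum_le _ _).trans (Finset.sum_le_sum fun W hW => ?_)))
      have hYp : IsPolymer (L ^ k) Y := (mem_polys.1 hY).2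
      have hZp : IsPolymer (L ^ k) Z := (mem_polys.1 hZ).2
      have hWp : IsPolymer (L ^ k) W := (mem_polys.1 hW).2
      set Z' := (X \ Y) \ Z with hZ'
      have hZ'p : IsPolymer (L ^ k) Z' := (hX.sdiff hYp).sdiff hZp
      have hWZ' : Disjoint W Z' := by
        rw [hZ']
        exact Finset.disjoint_of_subset_left (mem_polys.1 hW).1 Finset.disjoint_sdiff
      -- Lemma 8.3 / 9.3 at degree zero
      have hT := tayNormLE_bprod_expNegH_mul_abkm (p := p) (r₀ := r₀) (by omega) hLodd hM (by omega) (by omega)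
        (by omega) hB hδ₀ hδ₁ hh hh0 hA hWp hZ'p hWZ' hHσ hC0 (hKσ σ hσ) (factorises_mulExt hk1)
        (fun ψ => mulExt_empty ψ) (hKd σ) (hKloc σ)
      -- locality of the term for the gauge of `W ∪ Z'`
      have h𝔥 : 0 < P.𝔥 k := fieldWt_pos hh hL0 d k
      have hR : 0 < P.R k := by show (0 : ℝ) < (L : ℝ) ^ k; positivity
      have hPp : d / 2 + 1 ≤ P.p := by show d / 2 + 1 ≤ p; omega
      have hloc : IsGaugeLocal (P.gauge k (W ∪ Z'))
          (fun ψ => bprod (L ^ k) (fun B => expNegH (H + σ • U) B ψ) W * mulExt ((a + σ • b)) Z' ψ) := by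
        refine IsGaugeLocal.mul ?_ ?_
        · unfold TorusPolymer.bprod
          refine IsGaugeLocal.prod _ fun B hBW => ?_
          have hBX : B ⊆ W ∪ Z' := (hWp.subset_of_mem_blocks hBW).trans Finset.subset_union_left
          exact (isGaugeLocal_cexp_neg_eval h𝔥.ne' hR.ne' hPp (TorusPolymer.subset_thicken _ _) (H + σ • U)).of_norm_le
            fun ζ => norm_fieldGauge_mono_set _ _ _ (TorusPolymer.thicken_mono _ hBX) ζ
        · have hpoly : ∀ Y' ∈ components Z', IsPolymer (L ^ k) Y' := fun Y' hY' =>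
            (TorusPolymer.IsPolymer.of_mem_components hMo hLodd.pow hZ'p hY').1
          have hKeq : mulExt ((a + σ • b)) Z' = fun ψ => ∏ Y' ∈ components Z', (a + σ • b) Y' ψ := by
            funext ψ; exact mulExt_apply Z' ψ
          rw [hKeq]
          refine IsGaugeLocal.prod _ fun Y' hY' => ?_
          obtain ⟨hY'p, hY'c⟩ := TorusPolymer.IsPolymer.of_mem_components hMo hLodd.pow hZ'p hY'
          have hY'X : Y' ⊆ W ∪ Z' := by
            refine subset_trans ?_ Finset.subset_union_right
            rw [Literature.Barriers.CriticalPhenomena.LongRangePhi4.Polymer.eq_biUnion_components Z']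
            exact Finset.subset_biUnion_of_mem id hY'
          exact (isGaugeLocal_lineAct (haloc Y' hY'p hY'c) (hbloc Y' hY'p hY'c) σ).of_norm_le
            fun ζ => norm_fieldGauge_mono_set _ _ _ (TorusPolymer.thicken_mono _ hY'X) ζ
      have hpt := hT.norm_apply_le hloc (φ + ξ)
      have hpt' : ‖bprod (L ^ k) (fun B => expNegH (H + σ • U) B (φ + ξ)) W * mulExt (a + σ • b) Z' (φ + ξ)‖ ≤
          cW W Z' * Wt.weight k (W ∪ Z') (φ + ξ) := hpt
      -- the prefactor
      have h1 : ‖bprod (L ^ k) (fun B => 1 - expNegH (Ht + σ • Ut) B φ) Y‖ ≤ MY Y := hMY Y σ hσc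
      have h2 : ‖((-1 : ℂ) ^ (blocks (L ^ k) (Z \ W)).card)‖ = 1 := by simp
      have hMY0 : 0 ≤ MY Y := (norm_nonneg _).trans h1
      calc ‖bprod (L ^ k) (fun B => 1 - expNegH (Ht + σ • Ut) B φ) Y * (-1 : ℂ) ^ (blocks (L ^ k) (Z \ W)).card *
              (bprod (L ^ k) (fun B => expNegH (H + σ • U) B (φ + ξ)) W * mulExt (a + σ • b) ((X \ Y) \ Z) (φ + ξ))‖
          = ‖bprod (L ^ k) (fun B => 1 - expNegH (Ht + σ • Ut) B φ) Y‖ * ‖((-1 : ℂ) ^ (blocks (L ^ k) (Z \ W)).card)‖ *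
              ‖bprod (L ^ k) (fun B => expNegH (H + σ • U) B (φ + ξ)) W * mulExt (a + σ • b) Z' (φ + ξ)‖ := by
            rw [norm_mul, norm_mul]
        _ ≤ MY Y * 1 * (cW W Z' * Wt.weight k (W ∪ Z') (φ + ξ)) :=
            mul_le_mul (mul_le_mul h1 h2.le (norm_nonneg _) hMY0) hpt' (norm_nonneg _) (mul_nonneg hMY0 zero_le_one)
        _ = MY Y * (cW W ((X \ Y) \ Z) * Wt.weight k (W ∪ ((X \ Y) \ Z)) (φ + ξ)) := by rw [mul_one]

/-- **State fixed, intermediate slot free: `K_{k+1}` is ENTIRE along every line `H̃ + σŨ`.**  For `‖H‖_{k,0} ≤ ⅛`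
and one admissible activity `a`, `σ ↦ nextK (L^k) π μ_{k+1} (e^{−H}) (e^{−(H̃+σŨ)}) (mulExt a) U' φ` is
differentiable on all of `ℂ` (the line `(H + σ·0, a + σ·0)` of the previous theorem on arbitrarily large discs).
This is the pointwise-holomorphy input of the blocks B1–B3 of the second-order two-kernel slot.
[cite: AdamsBuchholzKoteckyMuller2019, Definition 6.5 (6.34) / Lemma 12.6 (12.53)] -/
theorem differentiable_nextK_abkm_freeHt {L N Mord R n p r₀ : ℕ} {θbar lam μ δ₁ δ₀ A𝒫 A𝒫' C₂ h A : ℝ}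
    {𝒞 : ℕ → (Fin d → ZMod M) → ℝ} (hd : 3 ≤ d) (hLodd : Odd L)
    (hM : M = L ^ N) {k : ℕ} (hkN : k + 1 ≤ N) (hp : d / 2 + 2 ≤ p) (hpM : p + d ≤ Mord)
    (hB : AbkmWeightBounds L N Mord R n θbar lam μ δ₁ δ₀ A𝒫 𝒞
      (abkmWeightData L N Mord R θbar (schedDelta δ₀ δ₁ N) 𝒞))
    (hδ₀ : 0 < δ₀) (hδ₁ : 0 < δ₁) (hh : 0 < h) (hh0 : hZeroSq d R δ₀ δ₁ ≤ h ^ 2) (hA1 : 1 ≤ A)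
    (π : Finset (Fin d → ZMod M) → Finset (Fin d → ZMod M)) (𝒞k : (Fin d → ZMod M) → ℝ)
    (hS : StepKernelBounds (abkmWeightData L N Mord R θbar (schedDelta δ₀ δ₁ N) 𝒞) L k A𝒫' C₂ 𝒞k)
    {H : RelevantHamiltonian ℂ d}
    (hH : hamNorm (fieldWt h (L : ℝ) d k) ((L : ℝ) ^ k) (L ^ (d * k)) H ≤ 1 / 8)
    {a : Finset (Fin d → ZMod M) → ((Fin d → ZMod M) → ℝ) → ℂ} {Ca : ℝ} (hCa : 0 ≤ Ca)
    (ha : WeakNormLE (abkmNormParams L N Mord R p r₀ h θbar A (schedDelta δ₀ δ₁ N) 𝒞) k a Ca)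
    (had : ∀ Y, ContDiff ℝ r₀ (a Y))
    (haloc : ∀ Y, IsPolymer (L ^ k) Y → IsConn Y →
      IsGaugeLocal ((abkmNormParams L N Mord R p r₀ h θbar A (schedDelta δ₀ δ₁ N) 𝒞).gauge k Y) (a Y))
    (Ht Ut : RelevantHamiltonian ℂ d) (U' : Finset (Fin d → ZMod M)) (φ : (Fin d → ZMod M) → ℝ) :
    Differentiable ℂ (fun σ : ℂ => nextK (L ^ k) π (stepMeasure 𝒞k) (expNegH H)
      (expNegH (Ht + σ • Ut)) (mulExt a) U' φ) := by
  intro σ₀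
  -- the zero activity is admissible
  have hb0 : WeakNormLE (abkmNormParams L N Mord R p r₀ h θbar A (schedDelta δ₀ δ₁ N) 𝒞) k
      (0 : Finset (Fin d → ZMod M) → ((Fin d → ZMod M) → ℝ) → ℂ) 0 := by
    have h0 := ha.smul (fun X => had X) (0 : ℝ)
    rw [zero_smul, abs_zero, zero_mul] at h0
    exact h0
  have hb0d : ∀ Y, ContDiff ℝ r₀ ((0 : Finset (Fin d → ZMod M) → ((Fin d → ZMod M) → ℝ) → ℂ) Y) :=
    fun Y => contDiff_const
  have hb0loc : ∀ Y, IsPolymer (L ^ k) Y → IsConn Y →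
      IsGaugeLocal ((abkmNormParams L N Mord R p r₀ h θbar A (schedDelta δ₀ δ₁ N) 𝒞).gauge k Y)
        ((0 : Finset (Fin d → ZMod M) → ((Fin d → ZMod M) → ℝ) → ℂ) Y) :=
    fun Y _ _ => fun ψ ψ' _ => rfl
  have hHR : ∀ σ ∈ ball (0 : ℂ) (‖σ₀‖ + 1),
      hamNorm (fieldWt h (L : ℝ) d k) ((L : ℝ) ^ k) (L ^ (d * k)) (H + σ • (0 : RelevantHamiltonian ℂ d)) ≤ 1 / 8 := by
    intro σ _; simpa using hH
  have hmain := differentiableOn_nextK_abkm_freeHt_lineAct hd hLodd hM hkN hp hpM hB hδ₀ hδ₁ hh hh0 hA1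
    π 𝒞k hS H 0 Ht Ut (a := a) (b := 0) hCa le_rfl ha hb0 had hb0d haloc hb0loc hHR U' φ
  have hmain' : DifferentiableOn ℂ (fun σ : ℂ => nextK (L ^ k) π (stepMeasure 𝒞k) (expNegH H)
      (expNegH (Ht + σ • Ut)) (mulExt a) U' φ) (ball (0 : ℂ) (‖σ₀‖ + 1)) :=
    hmain.congr fun σ _ => by simp
  exact hmain'.differentiableAt (isOpen_ball.mem_nhds (mem_ball_zero_iff.2 (by linarith [norm_nonneg σ₀])))

/-- **Bidisc form** (input shape of `weakNormLE_secondDiff_of_pointwise_holomorphic`): along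
`H̃ + σŨ + τṼ` the map is entire in `σ` for each `τ` and entire in `τ` for each `σ`.
[cite: AdamsBuchholzKoteckyMuller2019, Definition 6.5 (6.34) / Lemma 12.6 (12.53)] -/
theorem differentiable_nextK_abkm_freeHt_bidisc {L N Mord R n p r₀ : ℕ} {θbar lam μ δ₁ δ₀ A𝒫 A𝒫' C₂ h A : ℝ}
    {𝒞 : ℕ → (Fin d → ZMod M) → ℝ} (hd : 3 ≤ d) (hLodd : Odd L)
    (hM : M = L ^ N) {k : ℕ} (hkN : k + 1 ≤ N) (hp : d / 2 + 2 ≤ p) (hpM : p + d ≤ Mord)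
    (hB : AbkmWeightBounds L N Mord R n θbar lam μ δ₁ δ₀ A𝒫 𝒞
      (abkmWeightData L N Mord R θbar (schedDelta δ₀ δ₁ N) 𝒞))
    (hδ₀ : 0 < δ₀) (hδ₁ : 0 < δ₁) (hh : 0 < h) (hh0 : hZeroSq d R δ₀ δ₁ ≤ h ^ 2) (hA1 : 1 ≤ A)
    (π : Finset (Fin d → ZMod M) → Finset (Fin d → ZMod M)) (𝒞k : (Fin d → ZMod M) → ℝ)
    (hS : StepKernelBounds (abkmWeightData L N Mord R θbar (schedDelta δ₀ δ₁ N) 𝒞) L k A𝒫' C₂ 𝒞k)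
    {H : RelevantHamiltonian ℂ d}
    (hH : hamNorm (fieldWt h (L : ℝ) d k) ((L : ℝ) ^ k) (L ^ (d * k)) H ≤ 1 / 8)
    {a : Finset (Fin d → ZMod M) → ((Fin d → ZMod M) → ℝ) → ℂ} {Ca : ℝ} (hCa : 0 ≤ Ca)
    (ha : WeakNormLE (abkmNormParams L N Mord R p r₀ h θbar A (schedDelta δ₀ δ₁ N) 𝒞) k a Ca)
    (had : ∀ Y, ContDiff ℝ r₀ (a Y))
    (haloc : ∀ Y, IsPolymer (L ^ k) Y → IsConn Y →
      IsGaugeLocal ((abkmNormParams L N Mord R p r₀ h θbar A (schedDelta δ₀ δ₁ N) 𝒞).gauge k Y) (a Y))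
    (Ht Ut Vt : RelevantHamiltonian ℂ d) (U' : Finset (Fin d → ZMod M)) (φ : (Fin d → ZMod M) → ℝ) :
    (∀ τ : ℂ, Differentiable ℂ (fun σ : ℂ => nextK (L ^ k) π (stepMeasure 𝒞k) (expNegH H)
      (expNegH (Ht + σ • Ut + τ • Vt)) (mulExt a) U' φ)) ∧
    (∀ σ : ℂ, Differentiable ℂ (fun τ : ℂ => nextK (L ^ k) π (stepMeasure 𝒞k) (expNegH H)
      (expNegH (Ht + σ • Ut + τ • Vt)) (mulExt a) U' φ)) := by
  refine ⟨fun τ => ?_, fun σ => ?_⟩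
  · have h := differentiable_nextK_abkm_freeHt hd hLodd hM hkN hp hpM hB hδ₀ hδ₁ hh hh0 hA1 π 𝒞k hS hH
      hCa ha had haloc (Ht + τ • Vt) Ut U' φ
    have e : (fun σ : ℂ => nextK (L ^ k) π (stepMeasure 𝒞k) (expNegH H)
        (expNegH (Ht + σ • Ut + τ • Vt)) (mulExt a) U' φ) = (fun σ : ℂ => nextK (L ^ k) π (stepMeasure 𝒞k) (expNegH H)
        (expNegH (Ht + τ • Vt + σ • Ut)) (mulExt a) U' φ) := by
      funext σ; rw [add_right_comm]
    rw [e]; exact h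
  · exact differentiable_nextK_abkm_freeHt hd hLodd hM hkN hp hpM hB hδ₀ hδ₁ hh hh0 hA1 π 𝒞k hS hH
      hCa ha had haloc (Ht + σ • Ut) Vt U' φ

end Summit.HubbardSuperconductivity.HubbardSuperconductivity.Theorems.ComplexGFF

end
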